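import Summits.AtomisticToContinuum.Crystallization.Theorems.OneCentreSteepnessLadderZeroDensityOfDefectsTrialBlocks

/-!
# Route `OneCentreSteepnessLadder`, item `DominationEnergyLimit`: blocks are trial states for `V_q`

Helper file for item stmt-AtomisticToContinuum-12887 (`DominationEnergyLimit`).  The block
construction of `ChargedEnergyGap/Negative/Blocks*` (finite blocks `F + {Σ kᵢbᵢ : 0 ≤ kᵢ < K}` of a
periodic configuration `Q = F + G` of `ℝ³`) is written there for the Lennard-Jones potential with
inverse-SIXTH-power tails.  Here the same bookkeeping is redone for an ARBITRARY pair potential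
`V` with `V 0 = 0`, summable lattice sums over `Q`, and an inverse-power minorant
`V(r) ≥ −c·r⁻ⁿ` (`r > 0`) of ANY exponent `n > 3`:

* tails of exponent `n`: `tail_ipow_le_far`, `exists_far_ipow_lt`, `sum_tail_ipow_le`,
  `exists_sum_tail_ipow_le` (`Σ_u tail ≤ ε·2#F K³` for `K ≥ K₀`: deep block points see only the
  far part, non-deep ones are `≤ 6ρ'K²`);
* the exact identity `2·E(block_K) = K³·2#F·e(Q) − Σ_u tail_V(u)` (`two_mul_energy_block_eq_of`,
  from the sibling item's `OneCentreSteepnessLadderZeroDensity.two_mul_energy_block_eq_of_summable`);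
* **`exists_block_energy_le_of`**: for every `ε > 0` all large blocks have energy
  `≤ #block · (e(Q) + ε)`;
* the instance **`exists_block_energy_le_miePotential`** for the Mie `(2q,q)` potential, `q ≥ 4`
  (`V_q ≥ −(1/q)·r⁻⁴` on `(0,∞)`; lattice sums summable since `q > 3`, the sibling item's
  `OneCentreSteepnessLadderZeroDensity.summable_miePotential_dist`).

These `_of` lemmas supersede, for summable lattice sums and a minorant of any exponent `n > 3`,
the `(hfar, h6 : −A r⁻⁶ ≤ V, hA)` package of `MieRungEnergetic.*`
(`BrittleRungDescentMieRungPeriodic.lean`), which cannot serve `q = 4, 5` (no inverse-sixth-power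
floor for `V_q` on `[1, ∞)`); a librarian may re-derive the latter from the former.
All `[folklore]`; nothing here closes an item.
-/

noncomputable section

namespace Summit.AtomisticToContinuum.Crystallization.Theorems.DominationEnergyLimit

open Literature.MathematicalPhysics.StatisticalMechanics
open Summit.AtomisticToContinuum.Crystallization.Theorems.ChargedEnergyGapNegative
open Summit.AtomisticToContinuum.Crystallization.Theorems.ChargedEnergyGapNegative.Blocks
open Summit.AtomisticToContinuum.Crystallization.Theorems.OneCentreSteepnessLadderZeroDensity
  (miePotential_zero two_mul_energy_block_eq_of_summable summable_miePotential_dist)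
open scoped BigOperators

section Tails

variable (Q : PeriodicConfiguration 3) (K : ℕ) {n : ℕ}

/-! ### Inverse-power tails of exponent `n > 3` -/

/-- The inverse `n`-th power lattice sum at `p` is summable (`n > 3`). [folklore] -/
theorem summable_ipow (hn : 3 < n) (p : E3) :
    Summable fun q : {q : E3 // q ∈ Q.points ∧ q ≠ p} => (dist p q.1)⁻¹ ^ n :=
  Q.summable_inv_pow_dist hn p

/-- The inverse-power tail is at most the full inverse-power site sum at the block point.
[folklore] -/
theorem tail_ipow_le_siteSum_bpt (hn : 3 < n) (u : BIdx Q K) :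
    tail Q K (fun r => r⁻¹ ^ n) u ≤ siteSum Q (fun r => r⁻¹ ^ n) (bpt Q K u) := by
  unfold tail siteSum
  exact (summable_ipow Q hn (bpt Q K u)).tsum_subtype_le
    (fun q : {q : E3 // q ∈ Q.points ∧ q ≠ bpt Q K u} => (dist (bpt Q K u) q.1)⁻¹ ^ n)
    ((blockOthers Q K u : Set {q : E3 // q ∈ Q.points ∧ q ≠ bpt Q K u})ᶜ)
    (fun _ => by positivity)

/-- … which is translation invariant: `tail u ≤ siteSum (u.1)`. [folklore] -/
theorem tail_ipow_le_siteSum (hn : 3 < n) (u : BIdx Q K) :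
    tail Q K (fun r => r⁻¹ ^ n) u ≤ siteSum Q (fun r => r⁻¹ ^ n) u.1 := by
  have := tail_ipow_le_siteSum_bpt Q K hn u
  rwa [siteSum_bpt Q K (fun r => r⁻¹ ^ n) u] at this

/-- **Translation invariance of the far part** of the inverse-power site sum. [folklore] -/
theorem far_ipow_add {g : E3} (hg : g ∈ Q.lattice) (x : E3) (ρ : ℝ) :
    ∑' q : {q : {q : E3 // q ∈ Q.points ∧ q ≠ x + g} // ρ ≤ dist (x + g) q.1},
        (dist (x + g) q.1.1)⁻¹ ^ n =
      ∑' q : {q : {q : E3 // q ∈ Q.points ∧ q ≠ x} // ρ ≤ dist x q.1}, (dist x q.1.1)⁻¹ ^ n := by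
  rw [← Equiv.tsum_eq (farShiftEquiv Q hg x ρ)]
  congr 1
  funext q
  simp [farShiftEquiv, shiftEquiv, dist_add_right]

/-- If every point outside the block is at distance `≥ ρ` from the block point `u`, its
inverse-power tail is at most the far part at `u`'s own motif point. [folklore] -/
theorem tail_ipow_le_far (hn : 3 < n) (u : BIdx Q K) {ρ : ℝ}
    (hfar : ∀ q : {q : E3 // q ∈ Q.points ∧ q ≠ bpt Q K u}, q ∉ blockOthers Q K u →
      ρ ≤ dist (bpt Q K u) q.1) :
    tail Q K (fun r => r⁻¹ ^ n) u ≤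
      ∑' q : {q : {q : E3 // q ∈ Q.points ∧ q ≠ (u.1 : E3)} // ρ ≤ dist (u.1 : E3) q.1},
        (dist (u.1 : E3) q.1.1)⁻¹ ^ n := by
  have h1 : tail Q K (fun r => r⁻¹ ^ n) u ≤
      ∑' q : {q : {q : E3 // q ∈ Q.points ∧ q ≠ bpt Q K u} // ρ ≤ dist (bpt Q K u) q.1},
        (dist (bpt Q K u) q.1.1)⁻¹ ^ n := by
    unfold tail
    exact tsum_subtype_mono (summable_ipow Q hn (bpt Q K u)) (fun _ => by positivity)
      (fun q hq => hfar q (by simpa using hq))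
  have h2 := far_ipow_add Q (n := n) (latVec_mem Q (coords K u.2)) u.1 ρ
  simp only [bpt] at h1 ⊢
  rw [h2] at h1
  exact h1

/-- **The far part tends to zero**: for every `ε > 0` there is `ρ₀` beyond which the far part of
the inverse-power site sum at `x` is `< ε` (summability). [folklore] -/
theorem exists_far_ipow_lt (hn : 3 < n) (x : E3) {ε : ℝ} (hε : 0 < ε) :
    ∃ ρ₀ : ℝ, ∀ ρ, ρ₀ ≤ ρ →
      ∑' q : {q : {q : E3 // q ∈ Q.points ∧ q ≠ x} // ρ ≤ dist x q.1}, (dist x q.1.1)⁻¹ ^ n < ε := by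
  have ht : Filter.Tendsto (fun s : Finset {q : E3 // q ∈ Q.points ∧ q ≠ x} =>
      ∑' q : {q : {q : E3 // q ∈ Q.points ∧ q ≠ x} // q ∉ s}, (dist x q.1.1)⁻¹ ^ n)
      Filter.atTop (nhds 0) :=
    tendsto_tsum_compl_atTop_zero
      (fun q : {q : E3 // q ∈ Q.points ∧ q ≠ x} => (dist x q.1)⁻¹ ^ n)
  obtain ⟨s₀, hs₀⟩ := Filter.eventually_atTop.1 (ht.eventually (gt_mem_nhds hε))
  have hs₀' := hs₀ s₀ le_rfl
  refine ⟨(∑ q' ∈ s₀, dist x q'.1) + 1, fun ρ hρ => ?_⟩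
  have h1 : (∑ q' ∈ s₀, dist x q'.1) < ρ := lt_of_lt_of_le (lt_add_one _) hρ
  have hsub : ∀ q : {q : E3 // q ∈ Q.points ∧ q ≠ x}, ρ ≤ dist x q.1 → q ∉ s₀ := by
    intro q hq hqs
    have h2 := Finset.single_le_sum (s := s₀) (f := fun q' => dist x q'.1)
      (fun _ _ => dist_nonneg) hqs
    exact absurd (hq.trans h2) (not_le.2 h1)
  exact (tsum_subtype_mono (summable_ipow Q hn x) (fun _ => by positivity) hsub).trans_lt hs₀'

/-- **The far sums over the motif tend to zero.** [folklore] -/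
theorem exists_farSum_ipow_le (hn : 3 < n) {ε : ℝ} (hε : 0 < ε) : ∃ ρ₀ : ℝ, ∀ ρ, ρ₀ ≤ ρ →
    ∑ x ∈ Q.motif, ∑' q : {q : {q : E3 // q ∈ Q.points ∧ q ≠ x} // ρ ≤ dist x q.1},
      (dist x q.1.1)⁻¹ ^ n ≤ ε := by
  have hF : (0 : ℝ) < Q.motif.card := by exact_mod_cast Q.motif_nonempty.card_pos
  have hε' : 0 < ε / Q.motif.card := div_pos hε hF
  choose ρx hρx using fun x : E3 => exists_far_ipow_lt Q hn x hε'
  refine ⟨∑ x ∈ Q.motif, |ρx x|, fun ρ hρ => ?_⟩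
  have hle : ∀ x ∈ Q.motif,
      ∑' q : {q : {q : E3 // q ∈ Q.points ∧ q ≠ x} // ρ ≤ dist x q.1}, (dist x q.1.1)⁻¹ ^ n ≤
        ε / Q.motif.card := by
    intro x hx
    have h1 := Finset.single_le_sum (s := Q.motif) (f := fun x => |ρx x|)
      (fun _ _ => abs_nonneg _) hx
    exact (hρx x ρ ((le_abs_self _).trans (h1.trans hρ))).le
  calc _ ≤ ∑ _x ∈ Q.motif, ε / Q.motif.card := Finset.sum_le_sum hle
    _ = ε := by rw [Finset.sum_const, nsmul_eq_mul]; field_simp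

/-- Pointwise bound: the tail at `u = (x, k)` is at most the far part at `x` if `k` is
`ρ'(ρ)`-deep and at most the full site sum at `x` otherwise. [folklore] -/
theorem tail_ipow_le_ite (hn : 3 < n) (ρ : ℝ) (u : BIdx Q K) :
    tail Q K (fun r => r⁻¹ ^ n) u ≤
      (∑' q : {q : {q : E3 // q ∈ Q.points ∧ q ≠ (u.1 : E3)} // ρ ≤ dist (u.1 : E3) q.1},
        (dist (u.1 : E3) q.1.1)⁻¹ ^ n) +
      (if ¬ IsDeep K (depth Q ρ) u.2 then 1 else 0) * siteSum Q (fun r => r⁻¹ ^ n) u.1 := by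
  have hfar0 : 0 ≤ ∑' q : {q : {q : E3 // q ∈ Q.points ∧ q ≠ (u.1 : E3)} // ρ ≤ dist (u.1 : E3) q.1},
      (dist (u.1 : E3) q.1.1)⁻¹ ^ n := tsum_nonneg fun _ => by positivity
  by_cases h : IsDeep K (depth Q ρ) u.2
  · rw [if_neg (not_not_intro h), zero_mul, add_zero]
    exact tail_ipow_le_far Q K hn u (fun q hq => le_dist_of_deep Q K h q hq)
  · rw [if_pos h, one_mul]
    exact (tail_ipow_le_siteSum Q K hn u).trans (le_add_of_nonneg_left hfar0)

/-- **Sum of the inverse-power tails over a block**: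
`Σ_u tail u ≤ K³·farSum(ρ) + 6ρ'(ρ)K²·(Σ_{x ∈ F} siteSum x)`. [folklore] -/
theorem sum_tail_ipow_le (hn : 3 < n) (ρ : ℝ) :
    ∑ u : BIdx Q K, tail Q K (fun r => r⁻¹ ^ n) u ≤
      (K : ℝ) ^ 3 * (∑ x ∈ Q.motif,
        ∑' q : {q : {q : E3 // q ∈ Q.points ∧ q ≠ x} // ρ ≤ dist x q.1}, (dist x q.1.1)⁻¹ ^ n) +
      6 * (depth Q ρ) * (K : ℝ) ^ 2 * ∑ x ∈ Q.motif, siteSum Q (fun r => r⁻¹ ^ n) x := by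
  classical
  have hnd := card_not_deep_le K (depth Q ρ)
  have hsite0 : ∀ x : E3, 0 ≤ siteSum Q (fun r => r⁻¹ ^ n) x :=
    fun x => tsum_nonneg fun _ => by positivity
  set far : E3 → ℝ := fun x =>
    ∑' q : {q : {q : E3 // q ∈ Q.points ∧ q ≠ x} // ρ ≤ dist x q.1}, (dist x q.1.1)⁻¹ ^ n with hfar
  calc ∑ u : BIdx Q K, tail Q K (fun r => r⁻¹ ^ n) u
      ≤ ∑ u : BIdx Q K, (far u.1 +
          (if ¬ IsDeep K (depth Q ρ) u.2 then 1 else 0) * siteSum Q (fun r => r⁻¹ ^ n) u.1) :=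
        Finset.sum_le_sum fun u _ => tail_ipow_le_ite Q K hn ρ u
    _ = ∑ x : Q.motif, ((K : ℝ) ^ 3 * far x +
          ((Finset.univ.filter fun k : Fin 3 → Fin K => ¬ IsDeep K (depth Q ρ) k).card : ℝ) *
            siteSum Q (fun r => r⁻¹ ^ n) x) := by
        rw [Fintype.sum_prod_type]
        refine Finset.sum_congr rfl fun x _ => ?_
        dsimp only
        rw [Finset.sum_add_distrib, Finset.sum_const, Finset.card_univ, Fintype.card_fun,
          Fintype.card_fin, Fintype.card_fin, nsmul_eq_mul, ← Finset.sum_mul, Finset.sum_boole]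
        push_cast
        ring
    _ ≤ ∑ x : Q.motif, ((K : ℝ) ^ 3 * far x + (6 * (depth Q ρ) * (K : ℝ) ^ 2) *
          siteSum Q (fun r => r⁻¹ ^ n) x) := by
        refine Finset.sum_le_sum fun x _ => add_le_add le_rfl ?_
        exact mul_le_mul_of_nonneg_right (by exact_mod_cast hnd) (hsite0 x)
    _ = (K : ℝ) ^ 3 * (∑ x ∈ Q.motif, far x) +
          6 * (depth Q ρ) * (K : ℝ) ^ 2 * ∑ x ∈ Q.motif, siteSum Q (fun r => r⁻¹ ^ n) x := by
        rw [Finset.sum_add_distrib, ← Finset.mul_sum, ← Finset.mul_sum]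
        rw [Finset.sum_coe_sort Q.motif (fun x => far x),
          Finset.sum_coe_sort Q.motif (fun x => siteSum Q (fun r => r⁻¹ ^ n) x)]

/-- **The average inverse-power tail is eventually small**: for every `ε > 0` there is `K₀ ≥ 1`
with `Σ_u tail u ≤ ε · (2 #F K³)` for all `K ≥ K₀`. [folklore] -/
theorem exists_sum_tail_ipow_le (hn : 3 < n) {ε : ℝ} (hε : 0 < ε) :
    ∃ K₀ : ℕ, 0 < K₀ ∧ ∀ K : ℕ, K₀ ≤ K →
      ∑ u : BIdx Q K, tail Q K (fun r => r⁻¹ ^ n) u ≤ ε * (2 * Q.motif.card * (K : ℝ) ^ 3) := by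
  have hF : (0 : ℝ) < Q.motif.card := by exact_mod_cast Q.motif_nonempty.card_pos
  obtain ⟨ρ₀, hρ₀⟩ := exists_farSum_ipow_le Q hn (show 0 < ε * Q.motif.card by positivity)
  set ρ := ρ₀ with hρ
  have hfar := hρ₀ ρ le_rfl
  set Ssum : ℝ := ∑ x ∈ Q.motif, siteSum Q (fun r => r⁻¹ ^ n) x with hSsum
  have hSsum0 : 0 ≤ Ssum := Finset.sum_nonneg fun x _ => tsum_nonneg fun _ => by positivity
  obtain ⟨K₀, hK₀⟩ := exists_nat_gt (6 * (depth Q ρ) * Ssum / (ε * Q.motif.card))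
  refine ⟨K₀ + 1, Nat.succ_pos _, fun K hK => ?_⟩
  have hK1 : (1 : ℝ) ≤ K := by exact_mod_cast (show 1 ≤ K by omega)
  have hK' : 6 * (depth Q ρ) * Ssum / (ε * Q.motif.card) < K := by
    have : (K₀ : ℝ) < K := by exact_mod_cast Nat.lt_of_lt_of_le (Nat.lt_succ_self K₀) hK
    linarith
  have hbd : 6 * (depth Q ρ) * Ssum ≤ ε * Q.motif.card * K := by
    rw [div_lt_iff₀ (by positivity)] at hK'
    linarith
  calc ∑ u : BIdx Q K, tail Q K (fun r => r⁻¹ ^ n) u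
      ≤ (K : ℝ) ^ 3 * (∑ x ∈ Q.motif,
          ∑' q : {q : {q : E3 // q ∈ Q.points ∧ q ≠ x} // ρ ≤ dist x q.1}, (dist x q.1.1)⁻¹ ^ n) +
        6 * (depth Q ρ) * (K : ℝ) ^ 2 * Ssum := sum_tail_ipow_le Q K hn ρ
    _ ≤ (K : ℝ) ^ 3 * (ε * Q.motif.card) + (K : ℝ) ^ 2 * (ε * Q.motif.card * K) := by
        have h1 : (K : ℝ) ^ 3 * (∑ x ∈ Q.motif,
            ∑' q : {q : {q : E3 // q ∈ Q.points ∧ q ≠ x} // ρ ≤ dist x q.1}, (dist x q.1.1)⁻¹ ^ n) ≤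
            (K : ℝ) ^ 3 * (ε * Q.motif.card) :=
          mul_le_mul_of_nonneg_left hfar (by positivity)
        have h2 : 6 * (depth Q ρ) * (K : ℝ) ^ 2 * Ssum ≤ (K : ℝ) ^ 2 * (ε * Q.motif.card * K) := by
          have := mul_le_mul_of_nonneg_left hbd (by positivity : (0 : ℝ) ≤ (K : ℝ) ^ 2)
          linarith [this]
        linarith
    _ = ε * (2 * Q.motif.card * (K : ℝ) ^ 3) := by ring

end Tails

section Energy

variable (Q : PeriodicConfiguration 3) (K : ℕ) {V : ℝ → ℝ}

/-! ### The energy identity of a block for a general potential -/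

/-- **The energy identity of a block**: `2·E(block_K) = K³ · 2#F · e(Q) − Σ_u tail(u)` (the
sibling item's `two_mul_energy_block_eq_of_summable`, with the translation invariance of site sums
`siteSum (bpt u) = siteSum u.1` and `Σ_{x ∈ F} siteSum x = 2#F·e(Q)`). [folklore] -/
theorem two_mul_energy_block_eq_of (hV0 : V 0 = 0)
    (hVsum : ∀ p : E3, Summable fun q : {q : E3 // q ∈ Q.points ∧ q ≠ p} => V (dist p q.1)) :
    2 * interactionEnergy V (blockConfig Q K) =
      (K : ℝ) ^ 3 * (2 * Q.motif.card * Q.energyPerParticle V) - ∑ u : BIdx Q K, tail Q K V u := by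
  rw [two_mul_energy_block_eq_of_summable Q V hV0 K hVsum]
  congr 1
  rw [Finset.sum_congr rfl fun u _ => siteSum_bpt Q K V u, Fintype.sum_prod_type]
  simp only [Finset.sum_const, Finset.card_univ, Fintype.card_fun, Fintype.card_fin, nsmul_eq_mul]
  rw [← Finset.mul_sum, Finset.sum_coe_sort Q.motif (siteSum Q V), sum_siteSum_eq]
  push_cast
  ring

/-- **The `V`-tail is bounded below by the inverse-power tail**: if `V(r) ≥ −c r⁻ⁿ` for `r > 0`
(`c ≥ 0`, `n > 3`), then `tail_V u ≥ −c · tail_{r⁻ⁿ} u`. [folklore] -/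
theorem neg_tail_ipow_le_tail_of {n : ℕ} (hn : 3 < n) {c : ℝ}
    (hVlow : ∀ r, 0 < r → -(c * r⁻¹ ^ n) ≤ V r)
    (hVsum : ∀ p : E3, Summable fun q : {q : E3 // q ∈ Q.points ∧ q ≠ p} => V (dist p q.1))
    (u : BIdx Q K) :
    -(c * tail Q K (fun r => r⁻¹ ^ n) u) ≤ tail Q K V u := by
  unfold tail
  rw [← tsum_mul_left, ← tsum_neg]
  refine Summable.tsum_le_tsum (fun q => hVlow _ (dist_pos.2 (Ne.symm q.1.2.2))) ?_ ?_
  · exact (((summable_ipow Q hn (bpt Q K u)).subtype _).mul_left c).neg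
  · exact (hVsum (bpt Q K u)).subtype _

/-- **Blocks are trial states** for every potential `V` with `V 0 = 0`, summable lattice sums
over `Q` and an inverse-power minorant `V ≥ −c r⁻ⁿ` on `(0, ∞)` (`c ≥ 0`, `n > 3`): for every
`ε > 0`, all large blocks have energy at most `#block · (e(Q) + ε)`. [folklore] -/
theorem exists_block_energy_le_of (hV0 : V 0 = 0) {n : ℕ} (hn : 3 < n) {c : ℝ} (hc : 0 ≤ c)
    (hVlow : ∀ r, 0 < r → -(c * r⁻¹ ^ n) ≤ V r)
    (hVsum : ∀ p : E3, Summable fun q : {q : E3 // q ∈ Q.points ∧ q ≠ p} => V (dist p q.1))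
    {ε : ℝ} (hε : 0 < ε) :
    ∃ K₀ : ℕ, 0 < K₀ ∧ ∀ K : ℕ, K₀ ≤ K →
      interactionEnergy V (blockConfig Q K) ≤
        (Fintype.card (BIdx Q K) : ℝ) * (Q.energyPerParticle V + ε) := by
  obtain ⟨K₀, hK₀, hK⟩ := exists_sum_tail_ipow_le Q hn (show 0 < ε / (c + 1) by positivity)
  refine ⟨K₀, hK₀, fun K hKK => ?_⟩
  have hsum := hK K hKK
  have hid := two_mul_energy_block_eq_of Q K hV0 hVsum
  have htail : -(c * ∑ u : BIdx Q K, tail Q K (fun r => r⁻¹ ^ n) u) ≤ ∑ u : BIdx Q K, tail Q K V u := by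
    rw [Finset.mul_sum, ← Finset.sum_neg_distrib]
    exact Finset.sum_le_sum fun u _ => neg_tail_ipow_le_tail_of Q K hn hVlow hVsum u
  have hn' : ((Fintype.card (BIdx Q K) : ℕ) : ℝ) = Q.motif.card * (K : ℝ) ^ 3 := by
    exact_mod_cast card_BIdx Q K
  rw [hn']
  have hF : (0 : ℝ) ≤ Q.motif.card := Nat.cast_nonneg _
  have hK3 : (0 : ℝ) ≤ (K : ℝ) ^ 3 := by positivity
  have hc1 : c * (ε / (c + 1)) ≤ ε := by
    rw [mul_div_assoc', div_le_iff₀ (by positivity)]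
    nlinarith
  have h1 : c * ∑ u : BIdx Q K, tail Q K (fun r => r⁻¹ ^ n) u ≤
      ε * (2 * Q.motif.card * (K : ℝ) ^ 3) := by
    calc c * ∑ u : BIdx Q K, tail Q K (fun r => r⁻¹ ^ n) u
        ≤ c * (ε / (c + 1) * (2 * Q.motif.card * (K : ℝ) ^ 3)) := mul_le_mul_of_nonneg_left hsum hc
      _ = (c * (ε / (c + 1))) * (2 * Q.motif.card * (K : ℝ) ^ 3) := by ring
      _ ≤ ε * (2 * Q.motif.card * (K : ℝ) ^ 3) :=
          mul_le_mul_of_nonneg_right hc1 (by positivity)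
  nlinarith

end Energy

section Mie

/-! ### The Mie `(2q, q)` potential, `q ≥ 4` -/

/-- **Inverse-fourth-power minorant**: `V_q(r) ≥ −(1/q)·r⁻⁴` for `r > 0`, `q ≥ 4` (for `r ≥ 1`,
`V_q ≥ −(1/q) r⁻ᵠ ≥ −(1/q) r⁻⁴`; for `r < 1`, `V_q ≥ −1/(2q)` and `r⁻⁴ > 1`). [folklore] -/
theorem neg_inv_pow_four_le_miePotential {q : ℕ} (hq : 4 ≤ q) {r : ℝ} (hr : 0 < r) :
    -((1 / (q : ℝ)) * r⁻¹ ^ 4) ≤ miePotential q r := by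
  have hq0 : q ≠ 0 := by omega
  have hqpos : (0 : ℝ) < q := by exact_mod_cast (show 0 < q by omega)
  have hu0 : 0 ≤ r⁻¹ := inv_nonneg.2 hr.le
  rcases le_or_gt 1 r with h1 | h1
  · -- `r ≥ 1`: `r⁻ᵠ ≤ r⁻⁴`, and `V_q ≥ -(1/q) r⁻ᵠ`
    have hu1 : r⁻¹ ≤ 1 := inv_le_one_of_one_le₀ h1
    have hpow : r⁻¹ ^ q ≤ r⁻¹ ^ 4 := pow_le_pow_of_le_one hu0 hu1 hq
    have hsq : 0 ≤ 1 / (2 * (q : ℝ)) * r⁻¹ ^ (2 * q) := by positivity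
    rw [miePotential_apply]
    have : 1 / (q : ℝ) * r⁻¹ ^ q ≤ 1 / (q : ℝ) * r⁻¹ ^ 4 :=
      mul_le_mul_of_nonneg_left hpow (by positivity)
    linarith
  · -- `r < 1`: `V_q ≥ -1/(2q) ≥ -(1/q) ≥ -(1/q) r⁻⁴`
    have hu1 : 1 ≤ r⁻¹ := (one_le_inv₀ hr).2 h1.le
    have hpow : (1 : ℝ) ≤ r⁻¹ ^ 4 := one_le_pow₀ hu1
    have hlow := neg_one_div_le_miePotential hq0 r
    have : 1 / (2 * (q : ℝ)) ≤ 1 / (q : ℝ) * r⁻¹ ^ 4 := by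
      calc 1 / (2 * (q : ℝ)) ≤ 1 / (q : ℝ) := by
            rw [div_le_div_iff₀ (by positivity) hqpos]; nlinarith
        _ = 1 / (q : ℝ) * 1 := (mul_one _).symm
        _ ≤ 1 / (q : ℝ) * r⁻¹ ^ 4 := mul_le_mul_of_nonneg_left hpow (by positivity)
    rw [neg_div] at hlow
    linarith

/-- **Blocks are trial states for `V_q`** (`q ≥ 4`): for every periodic configuration `Q` of
`ℝ³` and every `ε > 0`, all large blocks of `Q` have Mie energy `≤ #block · (e_q(Q) + ε)`.
[folklore] -/
theorem exists_block_energy_le_miePotential (Q : PeriodicConfiguration 3) {q : ℕ} (hq : 4 ≤ q)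
    {ε : ℝ} (hε : 0 < ε) :
    ∃ K₀ : ℕ, 0 < K₀ ∧ ∀ K : ℕ, K₀ ≤ K →
      interactionEnergy (miePotential q) (blockConfig Q K) ≤
        (Fintype.card (BIdx Q K) : ℝ) * (Q.energyPerParticle (miePotential q) + ε) := by
  exact exists_block_energy_le_of Q (miePotential_zero (by omega : q ≠ 0)) (n := 4) (by norm_num)
    (c := 1 / (q : ℝ)) (by positivity) (fun r hr => neg_inv_pow_four_le_miePotential hq hr)
    (summable_miePotential_dist Q hq) hε

end Mie

end Summit.AtomisticToContinuum.Crystallization.Theorems.DominationEnergyLimit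

end
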